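import Literature.MathematicalPhysics.PowerSystems.LossyMultimachineLurieForm
import HarnessLib

/-!
# The classical model with transfer conductances as a Lur'e system, UNORDERED-LINES split
# presentation: one sine and one cosine channel per LINE `{p, q}`, `p < q`, feeding BOTH machines

Topic `Literature/MathematicalPhysics/PowerSystems`; namespace
`Literature.MathematicalPhysics.PowerSystems.InternalNode` (lit-2's printed network-reduced classical
model `InternalNode (n+1)`, reference machine `0`). Sequel of `LossyMultimachineLurieForm.lean` §7
(`toSplitLurie`: Pai's split presentation (3.43)–(3.45) with one sine and one cosine channel per
ORDERED pair, each feeding its source machine). Everything below is PROVED (no named facts).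

SOURCE (read on the page). M. A. Pai, *Power System Stability* (1981) [Pai1981] (scan
`galaxy-panama-498241976139844`), §3.6 eq. (3.35) p. 79 (chunk p0052): `M_i ω̇_i + D_i ω_i =
P_ei(δˢ) − P_ei(δ)`; §3.6.3 eqs. (3.43)–(3.45), pp. 86–90 (chunks p0056–p0058): «State Space Model
with Non-negligible Transfer Conductances (Non-uniform Damping)», `ẋ = Ax − B₁f(σ) − B₂g(σ)`,
`σ = Cx`, with — as printed — ONE nonlinearity `f_i(σ_i) = E_pE_qB_pq[sin(σ_i + δ_pqˢ) − sin δ_pqˢ]`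
and ONE `g_i(σ_i) = E_pE_qG_pq[cos(σ_i + δ_pqˢ) − cos δ_pqˢ]` per LINE `i = (p, q)`, `p < q`
(`m = n(n−1)/2` lines), the sine term entering machines `p` and `q` with OPPOSITE signs (the matrix
`B₁ = M⁻¹Kᵀ`-type incidence) and the cosine term with EQUAL signs (`B₂ = M⁻¹|K|ᵀ`).

WHY A SECOND PRESENTATION (census of record, gridfusion sos-2 2026-08-27T07:11Z–07:14Z, VALIDATED):
for the Lur'e–Postnikov SLAB certificate class (`LuriePostnikovSlabCertificate.lean`) the three
presentations of the SAME printed model are NOT equivalent as LMI feasibility problems, because the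
S-procedure treats every channel as an independent sector-bounded uncertainty: on «WSCC9-postB-SPdamp-
h12» the ORDERED split (§7, 12 active channels) is feasible only to a window of ≈ 3°, the polar
DIRECTED form (§4, 6 channels, irrational data) to ≈ 7.6°, and THIS unordered-lines split (6 active
channels, rational data) to ≈ 8.3°. The theorems are the same sentence kind in all three; this file
gives the third its kernel receptacle.

OBJECTS / THEOREMS (all `d : InternalNode (n+1)`):
* `lineInput d` — the input matrix on the channel type of §7, `κ ⊕ κ`, `κ = Fin (n+1) × Fin (n+1)`:
  column `inl (p,q)`, `p < q` (sine line): `+C_pq/M_p` in row `p`, `−C_qp/M_q` in row `q`; column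
  `inr (p,q)`, `p < q` (cosine line): `+D_pq/M_p` in row `p`, `+D_qp/M_q` in row `q`; every column
  with `p ≥ q` is ZERO (null channels — kept so that states, channels, `A`, `C`, `δ*`, `lurieState`
  and the solution bridge are LITERALLY those of §7). No symmetry of `B_ij`, `G_ij` is assumed
  (`C_qp`, `D_qp` are used in row `q`).
* `toSplitLurieLines δˢ := machineReference (D_i/M_i) refT lineInput [pairIncidence; pairIncidence]
  (splitShift δˢ)`; `toSplitLurieLines_A/_C/_δs/_nonlin/_slab` (`rfl` transfers from §7),
  `lineInput_inl_of_not_lt` / `lineInput_inr_of_not_lt` (null columns).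
* `toSplitLurieLines_field_inl` (**the speed block of the field IS lit-2's printed `accel`** at an
  equilibrium — the sum over lines regrouped per machine using `sin` odd / `cos` even),
  `toSplitLurieLines_field_inr`, `hasDerivWithinAt_lurieState_lines` (THE BRIDGE from
  `InternalNode.IsSolutionAt`), and the packaged **`lurieState_tendsto_zero_of_slabCertificate_lines`**
  (exact `SlabCertificate (toSplitLurieLines δˢ)` + sector facts on the slab + rank-one level facts ⇒
  every solution from `{slab, V ≤ c}` keeps it and has all `ω_i → ω_s`, `δ_p − δ_0 → δ_pˢ − δ_0ˢ`).
PRODUCER INDEX MAP (lines): states and the 2(n+1)² channels EXACTLY as in §7's map (sine `inl (p,q)`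
row-major, then cosine `inr (p,q)`); ACTIVE channels = those with `p < q` (for `n + 1 = 3`: sine
list positions 1, 2, 5 = pairs (0,1), (0,2), (1,2); cosine positions 10, 11, 14); `B = [Bω; 0]` with
the columns above; `C`, `δ*` as in §7 (`(Cx)_{(p,q)} = σ_p − σ_q`, `δ* = δ_pˢ − δ_qˢ (+ π/2)`); the
NULL channels (`p ≥ q`) have `B`-column `0` but (for `p > q`) a NONZERO `C`-row, so a certificate
puts `τ = lam = 0`, `a = −1`, `b = 1` there (then their rows/columns of `slabMatrix` vanish), mirrors
`γ_(p,q) = γ_(q,p)` and the rank-one `s`, and the `2(n+1)² + 2n + 1`-square PSD fact is the active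
one padded with zeros. Tree sign `ẋ = Ax − B F(Cx)`.

THREE COLUMNS. MODELLED: classical network-reduced model WITH transfer conductances as printed (MV-2
without «L»), any damping `D_i`; CERTIFIED given exact certificate data: the packaged ROA sentence;
VALIDATED: the feasibility census quoted above. Nothing here says a grid is stable.
-/

noncomputable section

open Real Set Filter Matrix Finset
open scoped Topology

namespace Literature.MathematicalPhysics.PowerSystems

namespace InternalNode

open LyapunovFunctionFamily

variable {n : ℕ} (d : InternalNode (n + 1))

/-- **The unordered-lines input matrix** on the split channel type: sine line `(p,q)`, `p < q`, feeds
`+C_pq/M_p` to machine `p` and `−C_qp/M_q` to machine `q`; cosine line `(p,q)`, `p < q`, feeds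
`+D_pq/M_p` and `+D_qp/M_q`; columns with `p ≥ q` are zero.
[cite: Pai1981, §3.6.3 eqs. (3.43)–(3.45) (the matrices B₁, B₂; one f and one g per line)] -/
def lineInput : Matrix (Fin (n + 1)) ((Fin (n + 1) × Fin (n + 1)) ⊕ (Fin (n + 1) × Fin (n + 1))) ℝ :=
  Matrix.of fun i k =>
    Sum.elim
      (fun k : Fin (n + 1) × Fin (n + 1) =>
        (if k.1 = i then (if k.1 < k.2 then d.C k.1 k.2 / d.M i else 0) else 0)
          - (if k.2 = i then (if k.1 < k.2 then d.C k.2 k.1 / d.M i else 0) else 0))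
      (fun k : Fin (n + 1) × Fin (n + 1) =>
        (if k.1 = i then (if k.1 < k.2 then d.Dtr k.1 k.2 / d.M i else 0) else 0)
          + (if k.2 = i then (if k.1 < k.2 then d.Dtr k.2 k.1 / d.M i else 0) else 0))
      k

/-- Null sine columns: `p ≥ q`. [cite: Pai1981, §3.6.3 eq. (3.43) (lines are `p < q`)] -/
theorem lineInput_inl_of_not_lt (i : Fin (n + 1)) {k : Fin (n + 1) × Fin (n + 1)} (hk : ¬k.1 < k.2) :
    d.lineInput i (Sum.inl k) = 0 := by
  simp [lineInput, hk]

/-- Null cosine columns: `p ≥ q`. [cite: Pai1981, §3.6.3 eq. (3.43) (lines are `p < q`)] -/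
theorem lineInput_inr_of_not_lt (i : Fin (n + 1)) {k : Fin (n + 1) × Fin (n + 1)} (hk : ¬k.1 < k.2) :
    d.lineInput i (Sum.inr k) = 0 := by
  simp [lineInput, hk]

/-- **lit-2's `InternalNode (n+1)` AS Pai's split Lur'e system (3.45) over UNORDERED lines**, reference
machine `0`: `λ_i = D_i/M_i`, `T = refT`, `Bω = lineInput`, `E = [pairIncidence; pairIncidence]`,
`δ* = splitShift δˢ` — the same states, channels, `A`, `C`, `δ*` as `toSplitLurie` (§7), another `B`.
All of `A`, `B`, `C` are rational in the printed data. [cite: Pai1981, §3.6.3 eqs. (3.43)–(3.45)] -/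
def toSplitLurieLines (δs : Fin (n + 1) → ℝ) :
    System (Fin (n + 1) ⊕ Fin n) ((Fin (n + 1) × Fin (n + 1)) ⊕ (Fin (n + 1) × Fin (n + 1))) :=
  System.machineReference (fun i => d.D i / d.M i) (refT n) d.lineInput
    (Matrix.fromRows (pairIncidence n) (pairIncidence n)) (splitShift δs)

/-- Same `A` as §7. [cite: Pai1981, §3.6.3 eq. (3.45)] -/
theorem toSplitLurieLines_A (δs : Fin (n + 1) → ℝ) :
    (d.toSplitLurieLines δs).A = (d.toSplitLurie δs).A := rfl

/-- Same `C` as §7. [cite: Pai1981, §3.6.3 eq. (3.43)] -/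
theorem toSplitLurieLines_C (δs : Fin (n + 1) → ℝ) :
    (d.toSplitLurieLines δs).C = (d.toSplitLurie δs).C := rfl

/-- Same `δ*` as §7. [cite: Pai1981, §3.6.3 eq. (3.44)] -/
theorem toSplitLurieLines_δs (δs : Fin (n + 1) → ℝ) :
    (d.toSplitLurieLines δs).δs = (d.toSplitLurie δs).δs := rfl

/-- Hence the same channel nonlinearity as §7. [cite: Pai1981, §3.6.3 eq. (3.44)] -/
theorem toSplitLurieLines_nonlin (δs : Fin (n + 1) → ℝ) :
    (d.toSplitLurieLines δs).nonlin = (d.toSplitLurie δs).nonlin := rfl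

/-- Hence the same slab. [cite: Pai1981, §3.6.3 eq. (3.43)] -/
theorem toSplitLurieLines_slab (δs : Fin (n + 1) → ℝ)
    (γ : (Fin (n + 1) × Fin (n + 1)) ⊕ (Fin (n + 1) × Fin (n + 1)) → ℝ) :
    (d.toSplitLurieLines δs).slab γ = (d.toSplitLurie δs).slab γ := rfl

omit d in
/-- Regrouping a sum over ordered pairs that is supported on the lines through machine `i`
(plumbing): `Σ_(p,q) ([p = i][p < q] g q + [q = i][p < q] g p) = Σ_{j ≠ i} g j`. [folklore] -/
private theorem sum_pair_collapse (i : Fin (n + 1)) (g : Fin (n + 1) → ℝ) :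
    ∑ k : Fin (n + 1) × Fin (n + 1),
        ((if k.1 = i then (if k.1 < k.2 then g k.2 else 0) else 0)
          + (if k.2 = i then (if k.1 < k.2 then g k.1 else 0) else 0))
      = ∑ j ∈ univ.erase i, g j := by
  rw [Finset.sum_add_distrib]
  have h1 : ∑ k : Fin (n + 1) × Fin (n + 1), (if k.1 = i then (if k.1 < k.2 then g k.2 else 0) else 0)
      = ∑ q, (if i < q then g q else 0) := by
    rw [Fintype.sum_prod_type_right]
    refine Fintype.sum_congr _ _ fun q => ?_
    rw [Finset.sum_eq_single i]
    · simp
    · intro p _ hp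
      simp [hp]
    · simp
  have h2 : ∑ k : Fin (n + 1) × Fin (n + 1), (if k.2 = i then (if k.1 < k.2 then g k.1 else 0) else 0)
      = ∑ p, (if p < i then g p else 0) := by
    rw [Fintype.sum_prod_type]
    refine Fintype.sum_congr _ _ fun p => ?_
    rw [Finset.sum_eq_single i]
    · simp
    · intro q _ hq
      simp [hq]
    · simp
  rw [h1, h2, ← Finset.sum_add_distrib, ← Finset.add_sum_erase univ _ (mem_univ i)]
  simp only [lt_irrefl, if_false, add_zero, zero_add]
  refine Finset.sum_congr rfl fun j hj => ?_
  have hji : j ≠ i := (Finset.mem_erase.1 hj).1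
  rcases lt_or_gt_of_ne hji with h | h
  · simp [h, not_lt_of_gt h]
  · simp [h, not_lt_of_gt h]

/-- **The speed equations in the unordered-lines presentation: lit-2's `accel` IS the speed block of
the field** (at an equilibrium `δˢ`) — the sum over lines regrouped per machine with `sin(δ_q − δ_p)
= −sin(δ_p − δ_q)` and `cos(δ_q − δ_p) = cos(δ_p − δ_q)`.
[cite: Pai1981, §3.6 eq. (3.35) and §3.6.3 eqs. (3.43)–(3.45); SauerPai1998, §9.4 eqs. (9.17)–(9.18)] -/
theorem toSplitLurieLines_field_inl {δs : Fin (n + 1) → ℝ} (heq : d.IsEquilibrium δs)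
    (δ ω : Fin (n + 1) → ℝ) (i : Fin (n + 1)) :
    (d.toSplitLurieLines δs).field (d.lurieState δs δ ω) (Sum.inl i) = d.accel δ ω i := by
  rw [toSplitLurieLines, System.machineReference_field_inl]
  set S := System.machineReference (fun i => d.D i / d.M i) (refT n) d.lineInput
    (Matrix.fromRows (pairIncidence n) (pairIncidence n)) (splitShift δs) with hSdef
  have hS : S = d.toSplitLurieLines δs := rfl
  have hN1 : ∀ k : Fin (n + 1) × Fin (n + 1), S.nonlin (d.lurieState δs δ ω) (Sum.inl k)
      = Real.sin (δ k.1 - δ k.2) - Real.sin (δs k.1 - δs k.2) := by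
    intro k
    rw [hS, toSplitLurieLines_nonlin]
    exact d.toSplitLurie_nonlin_inl δs δ ω k
  have hN2 : ∀ k : Fin (n + 1) × Fin (n + 1), S.nonlin (d.lurieState δs δ ω) (Sum.inr k)
      = Real.cos (δ k.1 - δ k.2) - Real.cos (δs k.1 - δs k.2) := by
    intro k
    rw [hS, toSplitLurieLines_nonlin]
    exact d.toSplitLurie_nonlin_inr δs δ ω k
  -- sine lines through machine `i`
  set gS : Fin (n + 1) → ℝ := fun j =>
    1 / d.M i * (d.C i j * (Real.sin (δ i - δ j) - Real.sin (δs i - δs j))) with hgS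
  have hptS : ∀ k : Fin (n + 1) × Fin (n + 1),
      d.lineInput i (Sum.inl k) * S.nonlin (d.lurieState δs δ ω) (Sum.inl k)
        = (if k.1 = i then (if k.1 < k.2 then gS k.2 else 0) else 0)
          + (if k.2 = i then (if k.1 < k.2 then gS k.1 else 0) else 0) := by
    rintro ⟨p, q⟩
    rw [hN1]
    simp only [lineInput, Matrix.of_apply, Sum.elim_inl, hgS]
    by_cases hpq : p < q
    · have hne : p ≠ q := ne_of_lt hpq
      by_cases hp : p = i
      · subst hp
        have hq : q ≠ p := fun h => hne h.symm
        simp [hpq, hq]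
        ring
      · by_cases hq : q = i
        · subst hq
          simp [hpq, hp]
          have hodd : Real.sin (δ p - δ q) - Real.sin (δs p - δs q)
              = -(Real.sin (δ q - δ p) - Real.sin (δs q - δs p)) := by
            rw [show δ p - δ q = -(δ q - δ p) by ring, show δs p - δs q = -(δs q - δs p) by ring,
              Real.sin_neg, Real.sin_neg]
            ring
          rw [hodd]
          ring
        · simp [hp, hq]
    · simp [hpq]
  -- cosine lines through machine `i`
  set gC : Fin (n + 1) → ℝ := fun j =>
    1 / d.M i * (d.Dtr i j * (Real.cos (δ i - δ j) - Real.cos (δs i - δs j))) with hgC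
  have hptC : ∀ k : Fin (n + 1) × Fin (n + 1),
      d.lineInput i (Sum.inr k) * S.nonlin (d.lurieState δs δ ω) (Sum.inr k)
        = (if k.1 = i then (if k.1 < k.2 then gC k.2 else 0) else 0)
          + (if k.2 = i then (if k.1 < k.2 then gC k.1 else 0) else 0) := by
    rintro ⟨p, q⟩
    rw [hN2]
    simp only [lineInput, Matrix.of_apply, Sum.elim_inr, hgC]
    by_cases hpq : p < q
    · have hne : p ≠ q := ne_of_lt hpq
      by_cases hp : p = i
      · subst hp
        have hq : q ≠ p := fun h => hne h.symm
        simp [hpq, hq]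
        ring
      · by_cases hq : q = i
        · subst hq
          simp [hpq, hp]
          have heven : Real.cos (δ p - δ q) - Real.cos (δs p - δs q)
              = Real.cos (δ q - δ p) - Real.cos (δs q - δs p) := by
            rw [← Real.cos_neg (δ q - δ p), ← Real.cos_neg (δs q - δs p)]
            ring_nf
          rw [heven]
          ring
        · simp [hp, hq]
    · simp [hpq]
  have hsum : ∑ k, d.lineInput i k * S.nonlin (d.lurieState δs δ ω) k
      = 1 / d.M i * (d.electricalPower δ i - d.electricalPower δs i) := by
    rw [Fintype.sum_sum_type, Fintype.sum_congr _ _ hptS, Fintype.sum_congr _ _ hptC,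
      sum_pair_collapse, sum_pair_collapse, d.electricalPower_sub_eq_sum_split δ δs i,
      Finset.mul_sum, ← Finset.sum_add_distrib]
    refine Finset.sum_congr rfl fun j _ => ?_
    simp only [hgS, hgC]
    ring
  rw [hsum]
  simp only [lurieState, Sum.elim_inl, accel, heq i]
  ring

/-- **The angle equations**: `field(lurieState(δ, ω))_{σ_a} = ω_{a+1} − ω_0` (as in §7).
[cite: Pai1981, §3.6.3 eq. (3.45)] -/
theorem toSplitLurieLines_field_inr (δs δ ω : Fin (n + 1) → ℝ) (a : Fin n) :
    (d.toSplitLurieLines δs).field (d.lurieState δs δ ω) (Sum.inr a) = ω a.succ - ω 0 := by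
  rw [toSplitLurieLines, System.machineReference_field_inr, refT_mulVec]
  simp [lurieState]

/-- **THE BRIDGE (unordered-lines presentation).** Along every solution `(δ, ω)` of the printed swing
equations (`InternalNode.IsSolutionAt`) the Lur'e state `t ↦ lurieState(δ(t), ω(t))` solves
`ẋ = Ax − BF(Cx)` for `toSplitLurieLines δˢ` within any time set.
[cite: Pai1981, §3.6 eqs. (3.35)–(3.36) and §3.6.3 eq. (3.45)] -/
theorem hasDerivWithinAt_lurieState_lines {δs : Fin (n + 1) → ℝ} (heq : d.IsEquilibrium δs)
    {δ ω : ℝ → Fin (n + 1) → ℝ} {s : Set ℝ} {t : ℝ} (hsol : d.IsSolutionAt δ ω t) :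
    HasDerivWithinAt (fun τ => d.lurieState δs (δ τ) (ω τ))
      ((d.toSplitLurieLines δs).field (d.lurieState δs (δ t) (ω t))) s t := by
  refine hasDerivWithinAt_pi.2 fun j => ?_
  rcases j with i | a
  · rw [d.toSplitLurieLines_field_inl heq]
    simp only [lurieState, Sum.elim_inl]
    exact ((hsol i).2.sub_const d.ωs).hasDerivWithinAt
  · rw [d.toSplitLurieLines_field_inr]
    simp only [lurieState, Sum.elim_inr]
    have h1 := (hsol a.succ).1
    have h0 := (hsol 0).1
    have h := (h1.sub h0).sub_const (δs a.succ - δs 0)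
    have h' : ω t a.succ - d.ωs - (ω t 0 - d.ωs) = ω t a.succ - ω t 0 := by ring
    rw [h'] at h
    exact h.hasDerivWithinAt

/-- **Region of attraction of the classical model WITH TRANSFER CONDUCTANCES, certified by an exact
Lur'e–Postnikov SLAB certificate on the unordered-lines presentation** (the packaged statement; same
sentence as §7's `lurieState_tendsto_zero_of_slabCertificate` on the other `B`). Data: lit-2's
`InternalNode (n+1)`, an equilibrium `δˢ`, an exact `Λ : SlabCertificate (toSplitLurieLines δˢ)`
[Pai §2.16 Theorem [18], finite-sector form], per-channel sector facts on the slab `γ` (`hsec`; from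
`channel_sector_sin(_narrow)` / `channel_sector_cos`; null channels `a = −1`, `b = 1`), rank-one level
facts and a level `c < γ_k²/s_k`. Then every solution `(δ, ω)` of the swing equations on `[0, ∞)`
whose initial Lur'e state lies in `{slab, V ≤ c}` keeps it for all `t ≥ 0` and tends to `0`: EVERY
`ω_i(t) → ω_s`, every `δ_p − δ_0 → δ_pˢ − δ_0ˢ`. NO observability / damping-pattern hypothesis.
MODELLED: classical network-reduced model with transfer conductances as printed; CERTIFIED given the
exact data; inner estimate.
[cite: Pai1981, §2.16 Theorem [18] eqs. (2.63)–(2.64), §3.6.3 eqs. (3.43)–(3.45); VuTuritsyn2017, §4.3 Theorem 1] -/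
theorem lurieState_tendsto_zero_of_slabCertificate_lines {δs : Fin (n + 1) → ℝ}
    (heq : d.IsEquilibrium δs) (Λ : SlabCertificate (d.toSplitLurieLines δs))
    {γ : (Fin (n + 1) × Fin (n + 1)) ⊕ (Fin (n + 1) × Fin (n + 1)) → ℝ}
    (hsec : ∀ k ξ, |ξ - splitShift δs k| ≤ γ k → Λ.a k ≤ Real.cos ξ ∧ Real.cos ξ ≤ Λ.b k)
    {s : (Fin (n + 1) × Fin (n + 1)) ⊕ (Fin (n + 1) × Fin (n + 1)) → ℝ} (hs0 : ∀ k, 0 < s k)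
    (hs : ∀ k, (s k • Λ.P - Matrix.vecMulVec ((d.toSplitLurieLines δs).C k)
      ((d.toSplitLurieLines δs).C k)).PosSemidef)
    {c : ℝ} (hc : ∀ k, c < γ k ^ 2 / s k)
    {δ ω : ℝ → Fin (n + 1) → ℝ} (hsol : ∀ t, 0 ≤ t → d.IsSolutionAt δ ω t)
    (h0 : d.lurieState δs (δ 0) (ω 0) ∈ (d.toSplitLurieLines δs).slab γ)
    (h0c : Λ.V (d.lurieState δs (δ 0) (ω 0)) ≤ c) :
    (∀ t, 0 ≤ t → d.lurieState δs (δ t) (ω t) ∈ (d.toSplitLurieLines δs).slab γ ∧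
        Λ.V (d.lurieState δs (δ t) (ω t)) ≤ c) ∧
      Tendsto (fun t => d.lurieState δs (δ t) (ω t)) atTop (𝓝 0) := by
  have key := Λ.well_subset_regionOfAttraction_of_rankOne (γ := γ) hsec hs0 hs hc h0 h0c
  exact key.2 (fun t => d.lurieState δs (δ t) (ω t)) rfl fun τ t ht =>
    d.hasDerivWithinAt_lurieState_lines heq (hsol t ht.1)

end InternalNode

end Literature.MathematicalPhysics.PowerSystems

end
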